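import Summits.SmoothPoincare4.SmoothPoincare4.Theses.ConvexBisection
import Summits.SmoothPoincare4.SmoothPoincare4.Theorems.AcyclicBisectionExists.Negative.TwistedDoubles
import Literature.Geometry.Symplectic.PlanarContactBoundary
import Literature.Topology.FourManifolds.Gluing
import Mathlib.Geometry.Manifold.LocalDiffeomorph

/-!
# Stub `stub_contactoPlanes` of line `modp-braid-orbits` (reshape r5) for crux
`ConvexBisection.AcyclicBisectionExists` (item stmt-SmoothPoincare4-10508, route route-SmoothPoincare4-ConvexBisection)

THE RE-GLUED IDENTIFICATION CARRIES THE INDUCED PLANE FIELD ONTO THE COMPLEX TANGENCIES.  For two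
compact Stein domains `(W₁, S₁)`, `(W₂, S₂)` with boundary data `b₁`, `b₂`
(`Literature.Topology.FourManifolds.BoundaryData`: an abstract 3-manifold `bᵢ.carrier` smoothly
embedded onto `∂Wᵢ` by `bᵢ.incl`), a diffeomorphism `φ : b₁.carrier ≅ b₂.carrier` and a
diffeomorphism `φ₀` of `b₁.carrier` whose differential carries the `S₁`-induced boundary plane field
`ξ₁' = boundaryPlaneField S₁.J b₁` (`Literature.Geometry.Symplectic.boundaryPlaneField`: the complex
tangencies `contactPlane S₁.J` pulled back along `d(b₁.incl)`) onto the pull-back `φ^* ξ₂'` of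
`ξ₂' = boundaryPlaneField S₂.J b₂` (the output of Giroux–Gray, stub `stub_girouxGray`), the composite
identification `ψ = φ₀ ≫ φ` satisfies the pointwise contact matching
`d(b₂.incl ∘ ψ)_z (ξ₁'_z) = contactPlane S₂.J (b₂.incl (ψ z))` consumed by the landed
`stub_glueWitness` / `Negative.Witness.ofTwistedGlue`.

This is the registered stub `stub_contactoPlanes` of the checked skeleton
`Cruxes/AcyclicBisectionExists/Lines/modp-braid-orbits.lean` (lead reshape r5).  Proof: the chain
rule `d(b₂.incl ∘ φ ∘ φ₀)_z = d(b₂.incl)_{φ (φ₀ z)} ∘ dφ_{φ₀ z} ∘ dφ₀_z` (Mathlib `mfderiv_comp`),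
`Submodule.map_comp`, the hypothesis `map dφ₀ ξ₁'_z = comap dφ (ξ₂'_{φ (φ₀ z)})`, surjectivity of the
differential `dφ` of a diffeomorphism (Mathlib `Diffeomorph.mfderivToContinuousLinearEquiv`, so
`map dφ (comap dφ X) = X`, `Submodule.map_comap_eq_of_surjective`), and the landed
`Negative.map_mfderiv_incl_boundaryPlaneField` (`d(b₂.incl)` maps `ξ₂'` onto `contactPlane S₂.J`,
`Negative/TwistedDoubles.lean`).
-/

noncomputable section

-- the prescribed namespace `Summit.<P>.<Sub>.…` duplicates `SmoothPoincare4` (P = Sub)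
set_option linter.dupNamespace false

open scoped Manifold ContDiff Topology ContinuousMap

namespace Summit.SmoothPoincare4.SmoothPoincare4.Theorems.AcyclicBisectionExists.ModpBraidOrbits

open Summit.SmoothPoincare4.SmoothPoincare4.Theorems.AcyclicBisectionExists.Negative
open Literature.Topology.FourManifolds (BoundaryData IsBoundaryGluing)
open Literature.Geometry.Symplectic (SteinStructure contactPlane boundaryPlaneField)

/-- **Stub `stub_contactoPlanes` (the re-glued identification carries `ξ₁'` onto `contactPlane S₂.J`).**
If `dφ₀` carries `ξ₁' = boundaryPlaneField S₁.J b₁` onto the pull-back `φ^* ξ₂'` of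
`ξ₂' = boundaryPlaneField S₂.J b₂`, then `d(b₂.incl ∘ φ ∘ φ₀)` carries `ξ₁'` onto the complex
tangencies `contactPlane S₂.J` pointwise: chain rule, `dφ` is a linear isomorphism (so
`map dφ ∘ comap dφ = id`), and `d(b₂.incl)` maps `ξ₂'` onto `contactPlane S₂.J`
(`Negative.map_mfderiv_incl_boundaryPlaneField`). [folklore] -/
theorem stub_contactoPlanes :
    ∀ (W₁ : Type) [TopologicalSpace W₁] [ChartedSpace (EuclideanHalfSpace 4) W₁]
        [IsManifold (𝓡∂ 4) ∞ W₁] [CompactSpace W₁]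
      (W₂ : Type) [TopologicalSpace W₂] [ChartedSpace (EuclideanHalfSpace 4) W₂]
        [IsManifold (𝓡∂ 4) ∞ W₂] [CompactSpace W₂]
      (S₁ : SteinStructure W₁) (S₂ : SteinStructure W₂)
      (b₁ : BoundaryData (𝓡∂ 4) W₁ (𝓡 3)) (b₂ : BoundaryData (𝓡∂ 4) W₂ (𝓡 3))
      (φ : b₁.carrier ≃ₘ⟮𝓡 3, 𝓡 3⟯ b₂.carrier) (φ₀ : b₁.carrier ≃ₘ⟮𝓡 3, 𝓡 3⟯ b₁.carrier),
      (∀ y, (boundaryPlaneField S₁.J b₁ y).map (mfderiv (𝓡 3) (𝓡 3) φ₀ y).toLinearMap =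
        (boundaryPlaneField S₂.J b₂ (φ (φ₀ y))).comap (mfderiv (𝓡 3) (𝓡 3) φ (φ₀ y)).toLinearMap) →
      ∀ z, Submodule.map (mfderiv (𝓡 3) (𝓡∂ 4) (b₂.incl ∘ (φ₀.trans φ)) z).toLinearMap
          (boundaryPlaneField S₁.J b₁ z) = contactPlane S₂.J (b₂.incl ((φ₀.trans φ) z)) := by
  intro W₁ _ _ _ _ W₂ _ _ _ _ S₁ S₂ b₁ b₂ φ φ₀ hφ₀ z
  -- smoothness of the three factors
  have hφ₀d : MDifferentiableAt (𝓡 3) (𝓡 3) φ₀ z := φ₀.mdifferentiable (by simp) _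
  have hφd : MDifferentiableAt (𝓡 3) (𝓡 3) φ (φ₀ z) := φ.mdifferentiable (by simp) _
  have hι₂ : MDifferentiableAt (𝓡 3) (𝓡∂ 4) b₂.incl (φ (φ₀ z)) :=
    b₂.isSmoothEmbedding.contMDiff.mdifferentiableAt (by simp)
  have hι₂φ : MDifferentiableAt (𝓡 3) (𝓡∂ 4) (b₂.incl ∘ φ) (φ₀ z) := hι₂.comp (φ₀ z) hφd
  -- `b₂.incl ∘ (φ₀ ≫ φ) = (b₂.incl ∘ φ) ∘ φ₀`
  have e0 : (b₂.incl ∘ ⇑(φ₀.trans φ)) = (b₂.incl ∘ ⇑φ) ∘ ⇑φ₀ := rfl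
  -- chain rule, twice
  have e1 : mfderiv (𝓡 3) (𝓡∂ 4) ((b₂.incl ∘ ⇑φ) ∘ ⇑φ₀) z =
      (mfderiv (𝓡 3) (𝓡∂ 4) (b₂.incl ∘ ⇑φ) (φ₀ z)).comp (mfderiv (𝓡 3) (𝓡 3) φ₀ z) :=
    mfderiv_comp z hι₂φ hφ₀d
  have e2 : mfderiv (𝓡 3) (𝓡∂ 4) (b₂.incl ∘ ⇑φ) (φ₀ z) =
      (mfderiv (𝓡 3) (𝓡∂ 4) b₂.incl (φ (φ₀ z))).comp (mfderiv (𝓡 3) (𝓡 3) φ (φ₀ z)) :=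
    mfderiv_comp (φ₀ z) hι₂ hφd
  -- `dφ` is surjective (a linear isomorphism)
  have hsurj : Function.Surjective (mfderiv (𝓡 3) (𝓡 3) φ (φ₀ z)).toLinearMap := by
    have := (φ.mfderivToContinuousLinearEquiv (by simp) (φ₀ z)).surjective
    rwa [← ContinuousLinearEquiv.coe_coe, Diffeomorph.mfderivToContinuousLinearEquiv_coe] at this
  -- assemble
  have step1 : Submodule.map (mfderiv (𝓡 3) (𝓡∂ 4) (b₂.incl ∘ ⇑(φ₀.trans φ)) z).toLinearMap
        (boundaryPlaneField S₁.J b₁ z) =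
      Submodule.map (mfderiv (𝓡 3) (𝓡∂ 4) (b₂.incl ∘ ⇑φ) (φ₀ z)).toLinearMap
        (Submodule.map (mfderiv (𝓡 3) (𝓡 3) φ₀ z).toLinearMap (boundaryPlaneField S₁.J b₁ z)) := by
    rw [← Submodule.map_comp, e0]
    exact congrArg (fun T : TangentSpace (𝓡 3) z →L[ℝ] TangentSpace (𝓡∂ 4) (b₂.incl (φ (φ₀ z))) =>
      Submodule.map T.toLinearMap (boundaryPlaneField S₁.J b₁ z)) e1
  have step2 : Submodule.map (mfderiv (𝓡 3) (𝓡∂ 4) (b₂.incl ∘ ⇑φ) (φ₀ z)).toLinearMap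
        (Submodule.map (mfderiv (𝓡 3) (𝓡 3) φ₀ z).toLinearMap (boundaryPlaneField S₁.J b₁ z)) =
      Submodule.map (mfderiv (𝓡 3) (𝓡∂ 4) b₂.incl (φ (φ₀ z))).toLinearMap
        (Submodule.map (mfderiv (𝓡 3) (𝓡 3) φ (φ₀ z)).toLinearMap
          (Submodule.comap (mfderiv (𝓡 3) (𝓡 3) φ (φ₀ z)).toLinearMap
            (boundaryPlaneField S₂.J b₂ (φ (φ₀ z))))) := by
    rw [hφ₀ z, ← Submodule.map_comp]
    exact congrArg (fun T : TangentSpace (𝓡 3) (φ₀ z) →L[ℝ] TangentSpace (𝓡∂ 4) (b₂.incl (φ (φ₀ z))) =>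
      Submodule.map T.toLinearMap
        (Submodule.comap (mfderiv (𝓡 3) (𝓡 3) φ (φ₀ z)).toLinearMap
          (boundaryPlaneField S₂.J b₂ (φ (φ₀ z))))) e2
  have step3 : Submodule.map (mfderiv (𝓡 3) (𝓡∂ 4) b₂.incl (φ (φ₀ z))).toLinearMap
        (Submodule.map (mfderiv (𝓡 3) (𝓡 3) φ (φ₀ z)).toLinearMap
          (Submodule.comap (mfderiv (𝓡 3) (𝓡 3) φ (φ₀ z)).toLinearMap
            (boundaryPlaneField S₂.J b₂ (φ (φ₀ z))))) =
      contactPlane S₂.J (b₂.incl (φ (φ₀ z))) := by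
    rw [Submodule.map_comap_eq_of_surjective hsurj, map_mfderiv_incl_boundaryPlaneField]
  exact step1.trans (step2.trans step3)

end Summit.SmoothPoincare4.SmoothPoincare4.Theorems.AcyclicBisectionExists.ModpBraidOrbits

end
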